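import Literature.NumberTheory.Sieve.DivisorPowerSums
import Literature.NumberTheory.Sieve.BombieriVinogradovReduction
import Literature.NumberTheory.Sieve.DrappeauDispersionMainKernel
import Literature.NumberTheory.Sieve.BombieriVinogradovFacts

/-!
# Main terms of the line `peel-to-drappeau` (crux `TypeI2Dilated`) — multiplicities and divisor sums

Bookkeeping for the main-terms chain of `stub_mainTerms` (stmt-Parity-14272).  The main terms are indexed
by triples `τ = (P, (q, r)) ∈ T ⊆ ℕ × ℕ × ℕ` (all coordinates `≥ 1`) through the modulus
`L_τ = lcm(q, r P) = Nat.lcm τ.2.1 (τ.2.2 * τ.1)`, and every bound per triple depends on `τ` only through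
`L_τ`.  Sums over `T` are therefore converted into sums over the modulus `L` with multiplicity, and finished
with the divisor-power sums of the tree (`Literature.NumberTheory.Sieve.DivisorPowerSums`).  We prove:

* `card_filter_lcm_eq_le` — the multiplicity `#{τ ∈ T : L_τ = L} ≤ τ(L)^3` (`P ∣ L`, `q ∣ L`, `r ∣ L`),
  and `card_filter_lcm_mul_eq_le` — the same for the moduli `L_τ f` (`#{τ : L_τ f = m} ≤ τ(m)^3`, the
  multiplicity hypothesis of the family Bombieri–Vinogradov step);
* `sum_triples_le` — `∑_{τ ∈ T} h(L_τ) ≤ ∑_{L ≤ X} τ(L)^3 h(L)` for `h ≥ 0` and `L_τ ≤ X` on `T`;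
* `exists_sum_sigma_zero_pow_div_totient_le` (the real-floor version is already the tree's
  `Literature.NumberTheory.Sieve.exists_sum_sigma_zero_pow_div_totient_le_real`) —
  `∑_{L ≤ X} τ(L)^j / φ(L) ≤ C_j (log X)^{2^{j+2}}` (`X ≥ 2`), from `1/φ(L) ≤ τ(L)/L` and the tree's
  `∑_{n ≤ X} τ(n)^r / n ≤ C_r (log X)^{2^{r+1}}`;
* `sum_divisors_totient_div_self_le` (`∑_{m ∣ n} φ(m)/m ≤ τ(n)`);
* `card_primIndexLe_le` (`#{(f, ψ*) : f ≤ K, ψ* primitive mod f} ≤ K^2`) and `card_filter_isPrimitive_le`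
  (`#{ψ* primitive mod d} ≤ d`);
* the `ℝ`-valued form `sigma_zero_le_of_dvd` (`τ(m) ≤ τ(n)` for `m ∣ n ≠ 0`) and
  `totient_mul_le_mul_totient` (`φ(g L) ≤ g φ(L)`).
-/

noncomputable section

namespace Summit.Parity.GeneralizedHardyLittlewood.Cruxes.TypeI2Dilated.PeelToDrappeau

namespace MainTermsAux

open Finset Real
open scoped ArithmeticFunction.sigma Classical
open Literature.NumberTheory.Sieve Literature.NumberTheory.Sieve.Drappeau2017

/-! ### Elementary divisor and totient inequalities -/

/-- `τ(m) ≤ τ(n)` for `m ∣ n`, `n ≠ 0` (real form of the tree's `sigma_zero_le_of_dvd`). [folklore] -/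
theorem sigma_zero_le_of_dvd {m n : ℕ} (h : m ∣ n) (hn : n ≠ 0) : (σ 0 m : ℝ) ≤ (σ 0 n : ℝ) := by
  exact_mod_cast Literature.NumberTheory.Sieve.sigma_zero_le_of_dvd hn h

/-- `φ(g L) ≤ g φ(L)` for all `g, L` (induction on `g`: `φ(p n) = p φ(n)` or `(p - 1) φ(n)` for a prime
`p`); used as `1/(g φ(L')) ≤ 1/φ(g L')` in range (iii) of the main terms.  The same statement exists as
`Literature.NumberTheory.Sieve.BFI.totient_mul_le` inside the 1.8k-line file
`BombieriFriedlanderIwaniecTheorem7StarSwitchPiece.lean`, which is deliberately NOT imported into this chain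
(it would pull the whole BFI Theorem 7* development into the main-term files for a ten-line lemma). [folklore] -/
theorem totient_mul_le_mul_totient (g L : ℕ) : Nat.totient (g * L) ≤ g * Nat.totient L := by
  induction g using Nat.recOnMul generalizing L with
  | zero => simp
  | one => simp
  | prime p hp =>
    by_cases h : p ∣ L
    · rw [Nat.totient_mul_of_prime_of_dvd hp h]
    · rw [Nat.totient_mul_of_prime_of_not_dvd hp h]
      exact Nat.mul_le_mul_right _ (Nat.sub_le p 1)
  | mul a b ha hb =>
    calc Nat.totient (a * b * L) = Nat.totient (a * (b * L)) := by rw [mul_assoc]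
      _ ≤ a * Nat.totient (b * L) := ha (b * L)
      _ ≤ a * (b * Nat.totient L) := Nat.mul_le_mul_left a (hb L)
      _ = a * b * Nat.totient L := by rw [mul_assoc]

/-- `∑_{m ∣ n} φ(m)/m ≤ τ(n)` (each term is at most `1`, `φ(m) ≤ m`). [folklore] -/
theorem sum_divisors_totient_div_self_le (n : ℕ) :
    ∑ m ∈ n.divisors, (Nat.totient m : ℝ) / (m : ℝ) ≤ (σ 0 n : ℝ) := by
  calc ∑ m ∈ n.divisors, (Nat.totient m : ℝ) / (m : ℝ) ≤ ∑ _m ∈ n.divisors, (1 : ℝ) := by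
        refine sum_le_sum fun m hm => ?_
        have hm0 : (0 : ℝ) < m := by exact_mod_cast Nat.pos_of_mem_divisors hm
        rw [div_le_one hm0]
        exact_mod_cast Nat.totient_le m
    _ = (σ 0 n : ℝ) := by
        rw [sum_const, nsmul_eq_mul, mul_one, ArithmeticFunction.sigma_zero_apply]

/-! ### Sizes of the character index sets -/

/-- `#{ψ* primitive mod d} ≤ #{χ mod d} = φ(d) ≤ d` for `d ≥ 1` (cf. the tree's
`Literature.NumberTheory.Sieve.card_filter_isPrimitive_le`, bound `φ(d)`, in `VaughanMeanValueDecomposition.lean`,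
not imported here). [folklore] -/
theorem card_filter_isPrimitive_le (d : ℕ) [NeZero d] :
    ((univ : Finset (DirichletCharacter ℂ d)).filter DirichletCharacter.IsPrimitive).card ≤ d := by
  haveI : NeZero ((Monoid.exponent (ZMod d)ˣ : ℕ) : ℂ) :=
    ⟨Nat.cast_ne_zero.mpr Monoid.exponent_ne_zero_of_finite⟩
  calc ((univ : Finset (DirichletCharacter ℂ d)).filter DirichletCharacter.IsPrimitive).card
      ≤ (univ : Finset (DirichletCharacter ℂ d)).card := card_filter_le _ _
    _ = Nat.totient d := by
        rw [Finset.card_univ, ← Nat.card_eq_fintype_card]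
        exact DirichletCharacter.card_eq_totient_of_hasEnoughRootsOfUnity ℂ d
    _ ≤ d := Nat.totient_le d

/-- `#primIndexLe K ≤ K^2` in `ℕ`: `primIndexLe K = Σ_{1 ≤ f ≤ K} {ψ* primitive mod f}` and each fibre has
at most `f ≤ K` elements. [folklore] -/
theorem card_primIndexLe_le_sq (K : ℕ) : (primIndexLe K).card ≤ K ^ 2 := by
  rw [primIndexLe, card_sigma]
  refine (sum_le_sum (g := fun _ => K) fun f hf => ?_).trans_eq ?_
  · have hf' := mem_Icc.1 hf
    haveI : NeZero f := ⟨by omega⟩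
    exact (card_filter_isPrimitive_le f).trans hf'.2
  · rw [sum_const, Nat.card_Icc, Nat.add_sub_cancel, smul_eq_mul, sq]

/-- `#primIndexLe K ≤ K^2` (real form): the number of pairs `(f, ψ*)`, `1 ≤ f ≤ K`, `ψ*` primitive
mod `f`. [folklore] -/
theorem card_primIndexLe_le (K : ℕ) : ((primIndexLe K).card : ℝ) ≤ (K : ℝ) ^ 2 := by
  exact_mod_cast card_primIndexLe_le_sq K

/-! ### Multiplicity of a modulus among the triples -/

/-- **Multiplicity of a modulus among the triples**: for `L ≥ 1`, the number of `τ = (P, (q, r)) ∈ T` with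
`lcm(q, r P) = L` is at most `τ(L)^3` (such a triple has `P ∣ L`, `q ∣ L`, `r ∣ L`). [this line] -/
theorem card_filter_lcm_eq_le (T : Finset (ℕ × ℕ × ℕ)) {L : ℕ} (hL : 0 < L) :
    (((T.filter (fun τ : ℕ × ℕ × ℕ => Nat.lcm τ.2.1 (τ.2.2 * τ.1) = L)).card : ℕ) : ℝ) ≤ (σ 0 L : ℝ) ^ 3 := by
  have hL0 : L ≠ 0 := hL.ne'
  have hsub : T.filter (fun τ : ℕ × ℕ × ℕ => Nat.lcm τ.2.1 (τ.2.2 * τ.1) = L) ⊆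
      L.divisors ×ˢ (L.divisors ×ˢ L.divisors) := by
    intro τ hτ
    rw [mem_filter] at hτ
    obtain ⟨-, hτL⟩ := hτ
    have h1 : τ.2.1 ∣ L := by rw [← hτL]; exact Nat.dvd_lcm_left _ _
    have h2 : τ.2.2 * τ.1 ∣ L := by rw [← hτL]; exact Nat.dvd_lcm_right _ _
    rw [mem_product, mem_product, Nat.mem_divisors, Nat.mem_divisors, Nat.mem_divisors]
    exact ⟨⟨(dvd_mul_left τ.1 τ.2.2).trans h2, hL0⟩, ⟨h1, hL0⟩, ⟨(dvd_mul_right τ.2.2 τ.1).trans h2, hL0⟩⟩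
  have h3 : (L.divisors ×ˢ (L.divisors ×ˢ L.divisors)).card = L.divisors.card ^ 3 := by
    rw [card_product, card_product]; ring
  calc (((T.filter (fun τ : ℕ × ℕ × ℕ => Nat.lcm τ.2.1 (τ.2.2 * τ.1) = L)).card : ℕ) : ℝ)
      ≤ (((L.divisors ×ˢ (L.divisors ×ˢ L.divisors)).card : ℕ) : ℝ) := by
        exact_mod_cast card_le_card hsub
    _ = (σ 0 L : ℝ) ^ 3 := by rw [h3, ArithmeticFunction.sigma_zero_apply, Nat.cast_pow]

/-- **Multiplicity for the moduli `L_τ f`**: if all coordinates of the triples in `T` are positive and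
`f ≥ 1`, then for every `m` the number of `τ ∈ T` with `lcm(q, r P) · f = m` is at most `τ(m)^3` (the form
of the multiplicity hypothesis `∀ m, #(T.filter (M · = m)) ≤ τ(m)^k` of the family Bombieri–Vinogradov
step `family_bv`). [this line] -/
theorem card_filter_lcm_mul_eq_le (T : Finset (ℕ × ℕ × ℕ)) (hT : ∀ τ ∈ T, 0 < τ.1 ∧ 0 < τ.2.1 ∧ 0 < τ.2.2)
    {f : ℕ} (hf : 0 < f) (m : ℕ) :
    (((T.filter (fun τ : ℕ × ℕ × ℕ => Nat.lcm τ.2.1 (τ.2.2 * τ.1) * f = m)).card : ℕ) : ℝ) ≤ (σ 0 m : ℝ) ^ 3 := by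
  rcases (T.filter (fun τ : ℕ × ℕ × ℕ => Nat.lcm τ.2.1 (τ.2.2 * τ.1) * f = m)).eq_empty_or_nonempty with
    hempty | ⟨τ₀, hτ₀⟩
  · rw [hempty, card_empty, Nat.cast_zero]
    positivity
  rw [mem_filter] at hτ₀
  obtain ⟨hτ₀T, hτ₀m⟩ := hτ₀
  obtain ⟨hP, hq, hr⟩ := hT τ₀ hτ₀T
  set L₀ : ℕ := Nat.lcm τ₀.2.1 (τ₀.2.2 * τ₀.1) with hL₀
  have hL₀pos : 0 < L₀ := Nat.lcm_pos hq (Nat.mul_pos hr hP)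
  have hm0 : m ≠ 0 := by rw [← hτ₀m]; exact (Nat.mul_pos hL₀pos hf).ne'
  have hL₀m : L₀ ∣ m := ⟨f, hτ₀m.symm⟩
  have hsub : T.filter (fun τ : ℕ × ℕ × ℕ => Nat.lcm τ.2.1 (τ.2.2 * τ.1) * f = m) ⊆
      T.filter (fun τ : ℕ × ℕ × ℕ => Nat.lcm τ.2.1 (τ.2.2 * τ.1) = L₀) := by
    intro τ hτ
    rw [mem_filter] at hτ ⊢
    refine ⟨hτ.1, Nat.eq_of_mul_eq_mul_right hf ?_⟩
    rw [hτ.2, hτ₀m]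
  calc (((T.filter (fun τ : ℕ × ℕ × ℕ => Nat.lcm τ.2.1 (τ.2.2 * τ.1) * f = m)).card : ℕ) : ℝ)
      ≤ (((T.filter (fun τ : ℕ × ℕ × ℕ => Nat.lcm τ.2.1 (τ.2.2 * τ.1) = L₀)).card : ℕ) : ℝ) := by
        exact_mod_cast card_le_card hsub
    _ ≤ (σ 0 L₀ : ℝ) ^ 3 := card_filter_lcm_eq_le T hL₀pos
    _ ≤ (σ 0 m : ℝ) ^ 3 := by
        gcongr
        exact_mod_cast Literature.NumberTheory.Sieve.sigma_zero_le_of_dvd hm0 hL₀m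

/-- **Sums over triples through the modulus**: for `h ≥ 0` and triples with positive coordinates and
`L_τ = lcm(q, r P) ≤ X`, `∑_{τ ∈ T} h(L_τ) ≤ ∑_{1 ≤ L ≤ X} τ(L)^3 h(L)` (fibrewise, with the multiplicity
bound `card_filter_lcm_eq_le`). [this line] -/
theorem sum_triples_le (T : Finset (ℕ × ℕ × ℕ)) (hT : ∀ τ ∈ T, 0 < τ.1 ∧ 0 < τ.2.1 ∧ 0 < τ.2.2) {X : ℕ}
    (hX : ∀ τ ∈ T, Nat.lcm τ.2.1 (τ.2.2 * τ.1) ≤ X) {h : ℕ → ℝ} (hh : ∀ L, 0 ≤ h L) :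
    ∑ τ ∈ T, h (Nat.lcm τ.2.1 (τ.2.2 * τ.1)) ≤ ∑ L ∈ Icc 1 X, (σ 0 L : ℝ) ^ 3 * h L := by
  have hmaps : ∀ τ ∈ T, Nat.lcm τ.2.1 (τ.2.2 * τ.1) ∈ Icc 1 X := fun τ hτ => by
    obtain ⟨hP, hq, hr⟩ := hT τ hτ
    exact mem_Icc.2 ⟨Nat.lcm_pos hq (Nat.mul_pos hr hP), hX τ hτ⟩
  rw [← sum_fiberwise_of_maps_to hmaps (fun τ : ℕ × ℕ × ℕ => h (Nat.lcm τ.2.1 (τ.2.2 * τ.1)))]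
  refine sum_le_sum fun L hL => ?_
  have hL0 : 0 < L := (mem_Icc.1 hL).1
  calc ∑ τ ∈ T.filter (fun τ : ℕ × ℕ × ℕ => Nat.lcm τ.2.1 (τ.2.2 * τ.1) = L), h (Nat.lcm τ.2.1 (τ.2.2 * τ.1))
      = ∑ _τ ∈ T.filter (fun τ : ℕ × ℕ × ℕ => Nat.lcm τ.2.1 (τ.2.2 * τ.1) = L), h L :=
        sum_congr rfl fun τ hτ => by rw [(mem_filter.1 hτ).2]
    _ = (((T.filter (fun τ : ℕ × ℕ × ℕ => Nat.lcm τ.2.1 (τ.2.2 * τ.1) = L)).card : ℕ) : ℝ) * h L := by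
        rw [sum_const, nsmul_eq_mul]
    _ ≤ (σ 0 L : ℝ) ^ 3 * h L := mul_le_mul_of_nonneg_right (card_filter_lcm_eq_le T hL0) (hh L)

/-! ### Divisor powers over Euler phi -/

/-- **Divisor powers over Euler phi**: `∑_{1 ≤ L ≤ X} τ(L)^j / φ(L) ≤ C_j (log X)^{2^{j+2}}` for `X ≥ 2`
(termwise `τ(L)^j/φ(L) ≤ τ(L)^{j+1}/L`, then the tree's `exists_sum_sigma_zero_pow_div_le` at `r = j + 1`).
[folklore] -/
theorem exists_sum_sigma_zero_pow_div_totient_le (j : ℕ) :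
    ∃ C : ℝ, 0 < C ∧ ∀ X : ℕ, 2 ≤ X →
      ∑ L ∈ Icc 1 X, (σ 0 L : ℝ) ^ j / (Nat.totient L : ℝ) ≤ C * Real.log X ^ (2 ^ (j + 2)) := by
  obtain ⟨C, hC, hsum⟩ := Literature.NumberTheory.Sieve.exists_sum_sigma_zero_pow_div_le (j + 1)
  refine ⟨C, hC, fun X hX => le_trans (sum_le_sum fun L _ => ?_) (hsum X hX)⟩
  rw [div_eq_mul_inv, pow_succ, mul_div_assoc]
  exact mul_le_mul_of_nonneg_left (Literature.NumberTheory.Sieve.inv_totient_le_sigma_zero_div L)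
    (by positivity)

end MainTermsAux

/-- Landing anchor of the main-terms chain (multiplicity file); registered stub `mainTermsChain3_anchor`. -/
theorem mainTermsChain3_anchor : True := trivial

end Summit.Parity.GeneralizedHardyLittlewood.Cruxes.TypeI2Dilated.PeelToDrappeau

end
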